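import Mathlib
import HarnessLib
import HarnessLib.Audit
import Summits.PneNP.PneNP.Theses.ForcedSplits

/-!
# Line `birth` — BC3 skeleton for the crux `CleanExitBound` (stmt-PneNP-8175)

Route `ForcedSplits` (route-PneNP-ForcedSplits), crux (rank 2) `CleanExitBound` = the DENSE CLEAN-EXIT
BOUND: there are `c, N` such that for all `n ≥ N` and every labelling `g : CNF → Bool` vanishing on
formulas with the empty clause, if `g` accepts `≥ 1/3` of the roots of `F₃(n, 6n)` then with probability
`≥ n^{-c}` the UP-guided path is UNCLEAN for `g` (accepted root, but the label sequence is not `1…10…0`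
with its unique drop at a free step whose sibling is labelled `1`). No complexity bound on `g`.

THE LINE = THE ROUTE'S OWN "FORESEEN SPLIT 2" (route header, TWO-LAYER PLAN): REDUCE DENSE TO
HEREDITARY. A labelling is HEREDITARY when its rejection set is closed under restriction
(`g ψ = false → g (ψ|v=b) = false`); along the flow a hereditary label sequence is automatically
monotone (`1…10…0`, no resurrection), so for hereditary `g` "unclean" is a FIRST-PASSAGE event — the
first entrance into the rejection ideal happens at a forced step or two-sidedly (card principle P1) —
which is the regime where the trajectory analysis of UC / ordered DLL on random 3-SAT (Chao–Franco,
Frieze–Suen, Achlioptas' card game: conditional uniformity of the residual formula) has purchase.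
Two named pieces and a real (short) seam:

* `stub_hereditaryCleanExit` — THE HEREDITARY CLEAN-EXIT BOUND, i.e. the route's rank-3 crux
  `Summit.PneNP.PneNP.Theses.ForcedSplits.HereditaryCleanExit` BY NAME (item stmt-PneNP-8176, open,
  staffed on its own): the bound `n^{-c}` for hereditary dense labellings only. Strictly a special
  case of the crux (one extra hypothesis); closes this stub the moment stmt-PneNP-8176 is proved.
* `stub_hereditaryDomination` — HEREDITARY DOMINATION AT POLYNOMIAL LOSS (new; the route's
  "HereditaryDomination", card principle P2): there are `d, N` such that for all `n ≥ N`, every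
  labelling `g` vanishing on formulas with `[]` and accepting `≥ 1/3` of the roots admits a HEREDITARY
  labelling `g'` (vanishing on `[]`, rejection closed under the route's inlined `restrict`, still
  accepting `≥ 1/3` of the roots) with `n^{-d} · Pr[g'(root) ∧ unclean for g'] ≤ Pr[g(root) ∧ unclean
  for g]`. The witness is free (`∃ g'` per `n` and `g`): the revival hull `g°(ψ) = [some iterated
  restriction of ψ is accepted by g]` (the least hereditary labelling above `g`: denser, vanishing on
  `[]`, monotone along every path) or a trimmed variant of it is the intended choice — P2's heuristic:
  an exit of `g` into a node that still has accepted descendants is either revived along the path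
  (a resurrection: unclean for `g`) or invisible to the flow, so hereditarising the flow-visible part
  of `g` changes the unclean probability by at most a polynomial factor. NOT a costume: with the
  trivial hereditary witness `g'₀ = [[] ∉ ψ]` (which drops exactly at the forced conflict step, so is
  unclean with probability `→ 1`) the inequality IS the crux again — the stub has content exactly in
  the freedom to choose `g'` adapted to `g`, and it is implied by the crux (a consequence used toward
  it, BC2-converse recorded), never the other way round without Stub 1.
* the SEAM (sorry-free, proved here): `cleanExitBound_of_sigs` — exponents add (`c + d`), thresholds
  agree (`1/3`), ranks `N = max N₁ N₂`; in `ℝ≥0∞`: `(n⁻¹)^(c+d) = (n⁻¹)^d · (n⁻¹)^c ≤ (n⁻¹)^d ·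
  Pr[unclean g'] ≤ Pr[unclean g]` (no `n ≠ 0` side condition needed). Its conclusion is the crux's
  body verbatim, so that `CleanExitBound_of` is the file's ONLY theorem whose head is the crux name
  (what `ledger skeleton check` keys on).
* `CleanExitBound_of : CleanExitBound` — THE skeleton theorem: the crux BY NAME from the two declared
  stubs (the only `sorry`s of the file).

Disproof used: none exists for this crux (`ledger crux ls stmt-PneNP-8175`: no workfiles, no
Disproof.lean, no crux ideas, 2026-08-17). Negatives honoured: `ledger negatives --problem PneNP` has
no statement about this flow; the route's own adversary census (marker families, the antisymmetric
`S − R` clock: unclean ≈ n^{-1/2}) constrains only the EXPONENT (`c ≥ 1/2`), and both stubs keep `∃ c` /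
`∃ d` free exactly as the crux does (typing checklist 4c(iv): no hand-picked threshold beyond the
route's own `1/3`).
BC3 probes (seat folder `bc/probe_*.lean`): `stub → CleanExitBound` and `stub → PneNP` by
`first | exact? | simpa | aesop` FAIL for both stubs (outputs recorded in the seat's NOTES.md and in
`Lines/birth.md`). Planner planner-skel-stmt-PneNP-8175-0, 2026-08-17.
-/

set_option linter.dupNamespace false
set_option linter.unusedVariables false

noncomputable section

namespace Summit.PneNP.PneNP.Cruxes.CleanExitBound.Birth

open Literature.Computability.Complexity
open Summit.PneNP.PneNP.Theses.ForcedSplits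

/-! ## The two registered stubs -/

/-- **Stub 1 (the hereditary clean-exit bound = route item stmt-PneNP-8176 `HereditaryCleanExit`, BY
NAME; open, size L).** For HEREDITARY labellings (rejection closed under restriction) vanishing on
formulas with the empty clause and accepting `≥ 1/3` of the roots of `F₃(n,6n)`, the UP-guided path is
unclean with probability `≥ n^{-c}` (`n ≥ N`). For such `g` the label sequence is monotone, so unclean =
"first entrance into the rejection ideal at a forced step, or two-sided" — a first-passage statement
about one explicit Markov chain. [cite: ChaoFranco1986] [cite: FriezeSuen1996] [cite: Achlioptas2001, §3
(card game / deferred decisions)] [cite: AchlioptasBeameMolloy2004] -/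
theorem stub_hereditaryCleanExit : Summit.PneNP.PneNP.Theses.ForcedSplits.HereditaryCleanExit := by
  sorry

/-- **Stub 2 (hereditary domination at polynomial loss; new, size XL — the dense-to-hereditary
reduction of the route's foreseen split 2 / card principle P2).** For `n ≥ N`, every labelling `g`
vanishing on formulas with `[]` and accepting `≥ 1/3` of the roots of `F₃(n,6n)` admits a hereditary
`g'` (vanishing on `[]`, `g' ψ = false → g' (restrict ψ v b) = false` for the route's inlined
`restrict`, accepting `≥ 1/3` of the roots) with `n^{-d} · Pr[g'(root) = 1 ∧ unclean for g'] ≤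
Pr[g(root) = 1 ∧ unclean for g]` on the route's flow `J n` (same inlined `restrict/step/run/J/clean`
as the crux, verbatim). Intended witness: the revival hull of (the flow-visible part of) `g`.
[cite: Achlioptas2001, §3] [cite: FriezeSuen1996] [folklore: none — conjectural reduction, card
forced-splits-up-guided-flux principle P2] -/
theorem stub_hereditaryDomination :
    let restrict : Literature.Computability.Complexity.CNF ℕ → ℕ → Bool → Literature.Computability.Complexity.CNF ℕ := fun ψ v b => (ψ.filter fun c => decide ((v, b) ∉ c)).map fun c => c.filter fun l => decide (l ≠ (v, !b)); let step : (n : ℕ) → Equiv.Perm (Fin n) → (Fin n → Bool) → Literature.Computability.Complexity.CNF ℕ × List (Literature.Computability.Complexity.CNF ℕ × ℕ × Bool × Bool) → Literature.Computability.Complexity.CNF ℕ × List (Literature.Computability.Complexity.CNF ℕ × ℕ × Bool × Bool) := fun n π β s => if ([] : Literature.Computability.Complexity.Clause ℕ) ∈ s.1 then s else (match s.1.find? fun c => c.length == 1 with | some c => (match c.head? with | some l => (restrict s.1 l.1 l.2, (s.1, l.1, l.2, true) :: s.2) | none => s) | none => (match (List.finRange n).find? fun i => decide ((π i : ℕ)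 ∉ s.2.map fun r => r.2.1) with | some i => (restrict s.1 (π i) (β (π i)), (s.1, ((π i : Fin n) : ℕ), β (π i), false) :: s.2) | none => s)); let run : (n : ℕ) → Literature.Computability.Complexity.CNF ℕ × Equiv.Perm (Fin n) × (Fin n → Bool) → Literature.Computability.Complexity.CNF ℕ × List (Literature.Computability.Complexity.CNF ℕ × ℕ × Bool × Bool) := fun n ω => (step n ω.2.1 ω.2.2)^[n] (ω.1, []); let J : (n : ℕ) → PMF (Literature.Computability.Complexity.CNF ℕ × Equiv.Perm (Fin n) × (Fin n → Bool)) := fun n => (Literature.Computability.Complexity.randomKCNF 3 n (6 * n)).bind fun φ => (PMF.uniformOfFintype (Equiv.Perm (Fin n) × (Fin n → Bool))).map fun r => (φ, r); let clean : (n : ℕ) → (Literature.Computability.Complexity.CNF ℕ → Bool) → Literature.Computability.Complexity.CNF ℕ × Equiv.Perm (Fin n) × (Fin n → Bool) → Prop := fun n g ω => ∃ a : ℕ, a < (run n ω).2.length ∧ (∀ t : ℕ, t ≤ (run n ω).2.length → ((((run n ω).2.reverse.map fun r => g r.1) ++ [g (run n ω).1]).getD t false = true ↔ t ≤ a)) ∧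 ((run n ω).2.reverse.getD a ([], 0, false, false)).2.2.2 = false ∧ g (restrict ((run n ω).2.reverse.getD a ([], 0, false, false)).1 ((run n ω).2.reverse.getD a ([], 0, false, false)).2.1 (!((run n ω).2.reverse.getD a ([], 0, false, false)).2.2.1)) = true; ∃ d N : ℕ, ∀ n ≥ N, ∀ g : Literature.Computability.Complexity.CNF ℕ → Bool, (∀ ψ : Literature.Computability.Complexity.CNF ℕ, ([] : Literature.Computability.Complexity.Clause ℕ) ∈ ψ → g ψ = false) → (1 / 3 : ENNReal) ≤ (J n).toOuterMeasure {ω | g ω.1 = true} → ∃ g' : Literature.Computability.Complexity.CNF ℕ → Bool, (∀ ψ : Literature.Computability.Complexity.CNF ℕ, ([] : Literature.Computability.Complexity.Clause ℕ) ∈ ψ → g' ψ = false) ∧ (∀ (ψ : Literature.Computability.Complexity.CNF ℕ) (v : ℕ) (b : Bool), g' ψ = false → g' (restrict ψ v b) = false) ∧ (1 / 3 : ENNReal) ≤ (J n).toOuterMeasure {ω | g' ω.1 = true} ∧ ((n : ENNReal)⁻¹) ^ d * (J n).toOuterMeasure {ω | g' ω.1 = true ∧ ¬ clean n g' ω} ≤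 (J n).toOuterMeasure {ω | g ω.1 = true ∧ ¬ clean n g ω} := by
  sorry

/-! ## The composition (sorry-free) -/

/-- **Composition with explicit hypotheses** (BC3 shape `hereditary-bound → domination → crux`; the
conclusion is the crux's body verbatim). Given the hereditary bound with `(c, N₁)` and domination with
`(d, N₂)`: for `n ≥ max N₁ N₂` and a dense `g` vanishing on `[]`, pick the hereditary dense `g'`;
then `(n⁻¹)^(c+d) = (n⁻¹)^d · (n⁻¹)^c ≤ (n⁻¹)^d · Pr[unclean g'] ≤ Pr[unclean g]`. [folklore] -/
theorem cleanExitBound_of_sigs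
    (hH : Summit.PneNP.PneNP.Theses.ForcedSplits.HereditaryCleanExit)
    (hD : let restrict : Literature.Computability.Complexity.CNF ℕ → ℕ → Bool → Literature.Computability.Complexity.CNF ℕ := fun ψ v b => (ψ.filter fun c => decide ((v, b) ∉ c)).map fun c => c.filter fun l => decide (l ≠ (v, !b)); let step : (n : ℕ) → Equiv.Perm (Fin n) → (Fin n → Bool) → Literature.Computability.Complexity.CNF ℕ × List (Literature.Computability.Complexity.CNF ℕ × ℕ × Bool × Bool) → Literature.Computability.Complexity.CNF ℕ × List (Literature.Computability.Complexity.CNF ℕ × ℕ × Bool × Bool) := fun n π β s => if ([] : Literature.Computability.Complexity.Clause ℕ) ∈ s.1 then s else (match s.1.find? fun c => c.length == 1 with | some c => (match c.head? with | some l => (restrict s.1 l.1 l.2, (s.1, l.1, l.2, true) :: s.2) | none => s) | none => (match (List.finRange n).find? fun i => decide ((π i : ℕ) ∉ s.2.map fun r => r.2.1) with | some i => (restrict s.1 (π i) (β (π i)), (s.1, ((π i : Fin n) : ℕ), β (π i), false) :: s.2) | none => s)); let run : (n : ℕ) → Literature.Computability.Complexity.CNF ℕ × Equiv.Perm (Fin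 n) × (Fin n → Bool) → Literature.Computability.Complexity.CNF ℕ × List (Literature.Computability.Complexity.CNF ℕ × ℕ × Bool × Bool) := fun n ω => (step n ω.2.1 ω.2.2)^[n] (ω.1, []); let J : (n : ℕ) → PMF (Literature.Computability.Complexity.CNF ℕ × Equiv.Perm (Fin n) × (Fin n → Bool)) := fun n => (Literature.Computability.Complexity.randomKCNF 3 n (6 * n)).bind fun φ => (PMF.uniformOfFintype (Equiv.Perm (Fin n) × (Fin n → Bool))).map fun r => (φ, r); let clean : (n : ℕ) → (Literature.Computability.Complexity.CNF ℕ → Bool) → Literature.Computability.Complexity.CNF ℕ × Equiv.Perm (Fin n) × (Fin n → Bool) → Prop := fun n g ω => ∃ a : ℕ, a < (run n ω).2.length ∧ (∀ t : ℕ, t ≤ (run n ω).2.length → ((((run n ω).2.reverse.map fun r => g r.1) ++ [g (run n ω).1]).getD t false = true ↔ t ≤ a)) ∧ ((run n ω).2.reverse.getD a ([], 0, false, false)).2.2.2 = false ∧ g (restrict ((run n ω).2.reverse.getD a ([], 0, false, false)).1 ((run n ω).2.reverse.getD a ([], 0, false, false)).2.1 (!((run n ω).2.reverse.getD a ([], 0,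 false, false)).2.2.1)) = true; ∃ d N : ℕ, ∀ n ≥ N, ∀ g : Literature.Computability.Complexity.CNF ℕ → Bool, (∀ ψ : Literature.Computability.Complexity.CNF ℕ, ([] : Literature.Computability.Complexity.Clause ℕ) ∈ ψ → g ψ = false) → (1 / 3 : ENNReal) ≤ (J n).toOuterMeasure {ω | g ω.1 = true} → ∃ g' : Literature.Computability.Complexity.CNF ℕ → Bool, (∀ ψ : Literature.Computability.Complexity.CNF ℕ, ([] : Literature.Computability.Complexity.Clause ℕ) ∈ ψ → g' ψ = false) ∧ (∀ (ψ : Literature.Computability.Complexity.CNF ℕ) (v : ℕ) (b : Bool), g' ψ = false → g' (restrict ψ v b) = false) ∧ (1 / 3 : ENNReal) ≤ (J n).toOuterMeasure {ω | g' ω.1 = true} ∧ ((n : ENNReal)⁻¹) ^ d * (J n).toOuterMeasure {ω | g' ω.1 = true ∧ ¬ clean n g' ω} ≤ (J n).toOuterMeasure {ω | g ω.1 = true ∧ ¬ clean n g ω}) :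
    let restrict : Literature.Computability.Complexity.CNF ℕ → ℕ → Bool → Literature.Computability.Complexity.CNF ℕ := fun ψ v b => (ψ.filter fun c => decide ((v, b) ∉ c)).map fun c => c.filter fun l => decide (l ≠ (v, !b)); let step : (n : ℕ) → Equiv.Perm (Fin n) → (Fin n → Bool) → Literature.Computability.Complexity.CNF ℕ × List (Literature.Computability.Complexity.CNF ℕ × ℕ × Bool × Bool) → Literature.Computability.Complexity.CNF ℕ × List (Literature.Computability.Complexity.CNF ℕ × ℕ × Bool × Bool) := fun n π β s => if ([] : Literature.Computability.Complexity.Clause ℕ) ∈ s.1 then s else (match s.1.find? fun c => c.length == 1 with | some c => (match c.head? with | some l => (restrict s.1 l.1 l.2, (s.1, l.1, l.2, true) :: s.2) | none => s) | none => (match (List.finRange n).find? fun i => decide ((π i : ℕ) ∉ s.2.map fun r => r.2.1) with | some i => (restrict s.1 (π i) (β (π i)), (s.1, ((π i : Fin n) : ℕ), β (π i), false) :: s.2) | none => s)); let run : (n : ℕ) → Literature.Computability.Complexity.CNF ℕ × Equiv.Perm (Fin n) × (Fin n → Bool) → Literature.Computability.Complexity.CNF ℕ × List (Literature.Computability.Complexity.CNF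 ℕ × ℕ × Bool × Bool) := fun n ω => (step n ω.2.1 ω.2.2)^[n] (ω.1, []); let J : (n : ℕ) → PMF (Literature.Computability.Complexity.CNF ℕ × Equiv.Perm (Fin n) × (Fin n → Bool)) := fun n => (Literature.Computability.Complexity.randomKCNF 3 n (6 * n)).bind fun φ => (PMF.uniformOfFintype (Equiv.Perm (Fin n) × (Fin n → Bool))).map fun r => (φ, r); let clean : (n : ℕ) → (Literature.Computability.Complexity.CNF ℕ → Bool) → Literature.Computability.Complexity.CNF ℕ × Equiv.Perm (Fin n) × (Fin n → Bool) → Prop := fun n g ω => ∃ a : ℕ, a < (run n ω).2.length ∧ (∀ t : ℕ, t ≤ (run n ω).2.length → ((((run n ω).2.reverse.map fun r => g r.1) ++ [g (run n ω).1]).getD t false = true ↔ t ≤ a)) ∧ ((run n ω).2.reverse.getD a ([], 0, false, false)).2.2.2 = false ∧ g (restrict ((run n ω).2.reverse.getD a ([], 0, false, false)).1 ((run n ω).2.reverse.getD a ([], 0, false, false)).2.1 (!((run n ω).2.reverse.getD a ([], 0, false, false)).2.2.1)) = true; ∃ c N : ℕ, ∀ n ≥ N, ∀ g : Literature.Computability.Complexity.CNF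 ℕ → Bool, (∀ ψ : Literature.Computability.Complexity.CNF ℕ, ([] : Literature.Computability.Complexity.Clause ℕ) ∈ ψ → g ψ = false) → (1 / 3 : ENNReal) ≤ (J n).toOuterMeasure {ω | g ω.1 = true} → ((n : ENNReal)⁻¹) ^ c ≤ (J n).toOuterMeasure {ω | g ω.1 = true ∧ ¬ clean n g ω} := by
  intro restrict step run J clean
  have hH' : ∃ c N : ℕ, ∀ n ≥ N, ∀ g : CNF ℕ → Bool, (∀ ψ : CNF ℕ, ([] : Clause ℕ) ∈ ψ → g ψ = false) →
      (∀ (ψ : CNF ℕ) (v : ℕ) (b : Bool), g ψ = false → g (restrict ψ v b) = false) →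
      (1 / 3 : ENNReal) ≤ (J n).toOuterMeasure {ω | g ω.1 = true} →
      ((n : ENNReal)⁻¹) ^ c ≤ (J n).toOuterMeasure {ω | g ω.1 = true ∧ ¬ clean n g ω} := hH
  have hD' : ∃ d N : ℕ, ∀ n ≥ N, ∀ g : CNF ℕ → Bool, (∀ ψ : CNF ℕ, ([] : Clause ℕ) ∈ ψ → g ψ = false) →
      (1 / 3 : ENNReal) ≤ (J n).toOuterMeasure {ω | g ω.1 = true} →
      ∃ g' : CNF ℕ → Bool, (∀ ψ : CNF ℕ, ([] : Clause ℕ) ∈ ψ → g' ψ = false) ∧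
        (∀ (ψ : CNF ℕ) (v : ℕ) (b : Bool), g' ψ = false → g' (restrict ψ v b) = false) ∧
        (1 / 3 : ENNReal) ≤ (J n).toOuterMeasure {ω | g' ω.1 = true} ∧
        ((n : ENNReal)⁻¹) ^ d * (J n).toOuterMeasure {ω | g' ω.1 = true ∧ ¬ clean n g' ω} ≤
          (J n).toOuterMeasure {ω | g ω.1 = true ∧ ¬ clean n g ω} := hD
  obtain ⟨c, N₁, hc⟩ := hH'
  obtain ⟨d, N₂, hd⟩ := hD'
  refine ⟨c + d, max N₁ N₂, ?_⟩
  intro n hn g hg0 hdense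
  obtain ⟨g', hg0', hher', hdense', hdom⟩ := hd n ((le_max_right N₁ N₂).trans hn) g hg0 hdense
  have hb := hc n ((le_max_left N₁ N₂).trans hn) g' hg0' hher' hdense'
  calc ((n : ENNReal)⁻¹) ^ (c + d) = ((n : ENNReal)⁻¹) ^ d * ((n : ENNReal)⁻¹) ^ c := by
        rw [pow_add, mul_comm]
    _ ≤ ((n : ENNReal)⁻¹) ^ d * (J n).toOuterMeasure {ω | g' ω.1 = true ∧ ¬ clean n g' ω} :=
        mul_le_mul' le_rfl hb
    _ ≤ (J n).toOuterMeasure {ω | g ω.1 = true ∧ ¬ clean n g ω} := hdom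

/-- **THE SKELETON THEOREM.** The crux `Summit.PneNP.PneNP.Theses.ForcedSplits.CleanExitBound`, concluded
BY NAME from the two DECLARED stubs `stub_hereditaryCleanExit` and `stub_hereditaryDomination` (the only
`sorry`s of the file) through the sorry-free composition `cleanExitBound_of_sigs`. [folklore] -/
theorem CleanExitBound_of : Summit.PneNP.PneNP.Theses.ForcedSplits.CleanExitBound :=
  cleanExitBound_of_sigs stub_hereditaryCleanExit stub_hereditaryDomination

end Summit.PneNP.PneNP.Cruxes.CleanExitBound.Birth

end
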